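import Summits.QuantumAdvantage.QuantumAdvantage.Theorems.CubicForrelationNearExactIsExactTwelveLevelFiveOffFlatB

/-!
# Crux `CubicForrelation.NearExactIsExact` (stmt-QuantumAdvantage-14043) — n = 12, level 5 in the whole window top: the residual off the
  hyperplane is a multiple of 16; annihilator sums of `u'`

Certificate seat `b2b-cforr-cert` (gen 13).  HONEST FRAMING: lemmas (standard axioms) for the level-5 analysis of the whole window top
`59/64 < Φ < 1` on 12 bits (`…TwelveLevelFiveOffFlatAll.lean`); finite-slice bookkeeping, NOT summit progress.

`tw5_off_flat_16`: cubic `f, g` on 12 bits, `W_g = 32·u'`, `P = {u' odd}` a coset `x_P ⊕ V` (`V ∋ 0` xor-closed, `#V = 2¹¹`), residual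
`e = u' − 2(−1)^f` (even off `P`) with `Σ_{x ∉ P} e² < 1024`.  Then `16 ∣ e` off `P`: on the other coset `p ⊕ V` the parametrised 4-, 5- and 7-flat
sums of `e` are `≡ 0 (mod 4 / 8 / 16)` (general flat sums `fs_flat_sum_dvd` of `u = 2u'` and Ax for `(−1)^f`), so by the Reed–Muller distance
on the abstract 11-flat (`ws_erm_round`) `e/2` is odd at `≥ 256` points (cost `≥ 1024`) or even, then `e/4` odd at `≥ 128` points (cost
`≥ 2048`) or even, then `e/8` odd at `≥ 32` points (cost `≥ 2048`) or even.  `tw5_annP`: `Σ_{ℓ = 0} u' ∈ {0, ±128}` for affine `ℓ` (Walsh inversion at `0` and at the normal vector).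

References: J. Ax (1964) / R. J. McEliece (1972); MacWilliams–Sloane (1977) Ch. 13 §3.  Everything below is proved from Mathlib and the tree;
axioms are the standard three.
-/

set_option linter.dupNamespace false -- D-0017: single-problem summit ⇒ `QuantumAdvantage.QuantumAdvantage` by design

noncomputable section

namespace Summit.QuantumAdvantage.QuantumAdvantage.Theorems.CubicForrelation.NearExactIsExact

open Finset
open Literature.Computability.QuantumComplexity
open Literature.Computability.QuantumComplexity.BuzetChailloux (bxor zeroVec bxor_bxor_cancel_left bxor_zeroVec zeroVec_bxor bxor_comm
  bxor_self twist_zeroVec_right)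
open Literature.Computability.QuantumComplexity.Simon (twist_eq_one_or)
open Literature.Computability.QuantumComplexity.DerivativeWalsh (W)

/-! ### Level 5 on 12 bits, step 1: the residual vanishes off the hyperplane -/

/-- **Off the hyperplane the residual is a multiple of 16.**  Cubic `f, g` on 12 bits with `W_g = 32u'`; `P = {u' odd}` a coset `x_P ⊕ V` of an
xor-closed `V ∋ 0` with `2¹¹` elements; if the residual `e = u' − 2(−1)^f` has `Σ_{x ∉ P} e(x)² ≤ 160` then `e = 0` off `P` (three rounds of
wild-point parity on the coset `p ⊕ V`, `p ∉ P`: `4 ∣ e` (4-flats), `8 ∣ e` (5-flats), `16 ∣ e` (7-flats), then `256 > bound`);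
general off-flat energy bound `< 256`. [this work] -/
theorem tw5_off_flat_16 (f g : (Fin (6 + 6) → Bool) → Bool) (hf : IsDegLeFun 3 f) (hg : IsDegLeFun 3 g)
    (u' : (Fin (6 + 6) → Bool) → ℤ) (hu' : ∀ x, W (fun y => signOf (g y)) x = (2 : ℝ) ^ 5 * (u' x : ℝ))
    (V : Finset (Fin (6 + 6) → Bool)) (xP : Fin (6 + 6) → Bool) (h0 : zeroVec ∈ V)
    (hadd : ∀ a ∈ V, ∀ b ∈ V, bxor a b ∈ V) (hcardV : #V = 2 ^ 11)
    (hS : (univ.filter fun x : Fin (6 + 6) → Bool => Odd (u' x)) = V.image (bxor xP))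
    (hoff_lt : ∑ x ∈ univ.filter (fun x => x ∉ (univ.filter fun x : Fin (6 + 6) → Bool => Odd (u' x))),
      (u' x - 2 * sZ (f x)) ^ 2 < 1024) :
    ∀ y, y ∉ (univ.filter fun x : Fin (6 + 6) → Bool => Odd (u' x)) → (16 : ℤ) ∣ u' y - 2 * sZ (f y) := by
  classical
  set P := univ.filter (fun x : Fin (6 + 6) → Bool => Odd (u' x)) with hPdef
  have hmemP : ∀ x, x ∈ P ↔ Odd (u' x) := fun x => by simp [hPdef]
  set u : (Fin (6 + 6) → Bool) → ℤ := fun x => 2 * u' x with hudef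
  have hu : ∀ x, W (fun y => signOf (g y)) x = (2 : ℝ) ^ 4 * (u x : ℝ) := by
    intro x; rw [hu' x]; simp only [u]; push_cast; ring
  set e : (Fin (6 + 6) → Bool) → ℤ := fun x => u' x - 2 * sZ (f x) with hedef
  show ∀ y, y ∉ P → (16 : ℤ) ∣ e y
  have heeven : ∀ x, x ∉ P → Even (e x) := by
    intro x hx
    have hev : Even (u' x) := Int.not_odd_iff_even.1 fun h => hx ((hmemP x).2 h)
    exact Int.even_sub.2 (iff_of_true hev ⟨sZ (f x), two_mul _⟩)
  have hPV' : ∀ x, x ∉ P → ∀ a ∈ V, bxor x a ∉ P := fun x hx a ha => fl1_coset_out' hadd hS hx ha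
  have hcos_out : ∀ p, p ∉ P → ∀ b ∈ V.image (bxor p), b ∉ P := by
    intro p hp b hb
    obtain ⟨v, hv, rfl⟩ := mem_image.1 hb
    exact hPV' p hp v hv
  have hoff_count : ∀ (T : Finset (Fin (6 + 6) → Bool)) (c : ℤ), (∀ x ∈ T, x ∉ P) → (∀ x ∈ T, c ≤ e x ^ 2) →
      c * #T < 1024 := by
    intro T c hT hc
    calc c * #T = ∑ x ∈ T, c := by rw [sum_const, nsmul_eq_mul, mul_comm]
      _ ≤ ∑ x ∈ T, e x ^ 2 := sum_le_sum hc
      _ ≤ ∑ x ∈ univ.filter (fun x => x ∉ P), e x ^ 2 :=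
          sum_le_sum_of_subset_of_nonneg (fun x hx => mem_filter.2 ⟨mem_univ _, hT x hx⟩) fun x _ _ => sq_nonneg _
      _ < 1024 := hoff_lt
  -- flat sums of `e = u' − 2s`: `4 ∣` on 4-flats, `8 ∣` on 5-flats, `16 ∣` on 7-flats
  have hflat : ∀ (k c : ℕ) (M : ℤ), (2 : ℤ) ^ (c + 1) = 2 * M → 4 + (c + 1) ≤ k + (6 + 6 - k + 2) / 3 → M ∣ 2 * 2 ^ ((k + 2) / 3) →
      ∀ (b : Fin (6 + 6) → Bool) (a : Fin k → Fin (6 + 6) → Bool),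
      M ∣ ∑ ε : Fin k → Bool, e (fun j => b j ^^ decide (Odd #(univ.filter fun i => ε i && a i j))) := by
    intro k c M hM hk hM' b a
    have h1 := fs_flat_sum_dvd (e := c + 1) g u hg hu b a hk
    obtain ⟨zf, hzf⟩ := sl_sum_sZ_flat f hf b a
    have hzf' : ∑ ε : Fin k → Bool, 2 * sZ (f (fun j => b j ^^ decide (Odd #(univ.filter fun i => ε i && a i j)))) =
        2 * 2 ^ ((k + 2) / 3) * zf := by
      rw [← mul_sum, hzf, ← mul_assoc]
    have h1' : 2 * M ∣ 2 * ∑ ε : Fin k → Bool, u' (fun j => b j ^^ decide (Odd #(univ.filter fun i => ε i && a i j))) := by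
      rw [← hM, mul_sum]; exact h1
    have h1'' : M ∣ ∑ ε : Fin k → Bool, u' (fun j => b j ^^ decide (Odd #(univ.filter fun i => ε i && a i j))) :=
      (mul_dvd_mul_iff_left two_ne_zero).1 h1'
    have h3 : ∑ ε : Fin k → Bool, e (fun j => b j ^^ decide (Odd #(univ.filter fun i => ε i && a i j))) =
        ∑ ε : Fin k → Bool, u' (fun j => b j ^^ decide (Odd #(univ.filter fun i => ε i && a i j))) -
        ∑ ε : Fin k → Bool, 2 * sZ (f (fun j => b j ^^ decide (Odd #(univ.filter fun i => ε i && a i j)))) := by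
      rw [← sum_sub_distrib]
    rw [h3, hzf']
    exact dvd_sub h1'' (dvd_mul_of_dvd_left hM' _)
  have hflat4 := hflat 4 2 4 (by norm_num) (by norm_num) (by norm_num)
  have hflat5 := hflat 5 3 8 (by norm_num) (by norm_num) (by norm_num)
  have hflat7 := hflat 7 4 16 (by norm_num) (by norm_num) (by norm_num)
  -- round 1: `4 ∣ e` off `P`
  have hdiv4 : ∀ y, y ∉ P → (4 : ℤ) ∣ e y := by
    by_contra hcon
    push Not at hcon
    obtain ⟨p, hp, hp4⟩ := hcon
    have hp2 : ∀ y, y ∉ P → e y = 2 * (e y / 2) := fun y hy =>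
      (Int.mul_ediv_cancel' (even_iff_two_dvd.1 (heeven y hy))).symm
    rcases ws_erm_round V h0 hadd hcardV p (fun y => e y / 2) 3 (fun b hb a ha => by
        have hpts : ∀ ε : Fin (3 + 1) → Bool, (fun j => b j ^^ decide (Odd #(univ.filter fun i => ε i && a i j))) ∉ P :=
          fun ε => ws_flatPt_mem V h0 (· ∉ P) hPV' (3 + 1) b (hcos_out p hp b hb) a ha ε
        have h4 := hflat4 b a
        rw [sum_congr rfl fun ε _ => hp2 _ (hpts ε), ← mul_sum] at h4
        obtain ⟨k, hk⟩ := h4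
        exact ⟨k, by linarith⟩) with hev | hbig
    · have := hev p (mem_image.2 ⟨zeroVec, h0, bxor_zeroVec p⟩)
      apply hp4
      obtain ⟨k, hk⟩ := this
      exact ⟨k, by rw [hp2 p hp, hk]; ring⟩
    · have hT := hoff_count ((V.image (bxor p)).filter fun x => Odd (e x / 2)) 4
        (fun x hx => hcos_out p hp x (mem_filter.1 hx).1) (fun x hx => by
          have hx' := (mem_filter.1 hx)
          have hxP : x ∉ P := hcos_out p hp x hx'.1
          have h0' := Int.odd_iff.1 hx'.2
          have h2 := hp2 x hxP
          have : e x ≤ -2 ∨ 2 ≤ e x := by omega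
          have := tp_sq_ge (k := 2) (by norm_num) this
          linarith)
      norm_num at hbig
      have : (256 : ℤ) ≤ #((V.image (bxor p)).filter fun x => Odd (e x / 2)) := by exact_mod_cast (by omega)
      linarith
  -- round 2: `8 ∣ e` off `P`
  have hdiv8 : ∀ y, y ∉ P → (8 : ℤ) ∣ e y := by
    by_contra hcon
    push Not at hcon
    obtain ⟨p, hp, hp8⟩ := hcon
    have hp4 : ∀ y, y ∉ P → e y = 4 * (e y / 4) := fun y hy => (Int.mul_ediv_cancel' (hdiv4 y hy)).symm
    rcases ws_erm_round V h0 hadd hcardV p (fun y => e y / 4) 4 (fun b hb a ha => by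
        have hpts : ∀ ε : Fin (4 + 1) → Bool, (fun j => b j ^^ decide (Odd #(univ.filter fun i => ε i && a i j))) ∉ P :=
          fun ε => ws_flatPt_mem V h0 (· ∉ P) hPV' (4 + 1) b (hcos_out p hp b hb) a ha ε
        have h8 := hflat5 b a
        rw [sum_congr rfl fun ε _ => hp4 _ (hpts ε), ← mul_sum] at h8
        obtain ⟨k, hk⟩ := h8
        exact ⟨k, by linarith⟩) with hev | hbig
    · have := hev p (mem_image.2 ⟨zeroVec, h0, bxor_zeroVec p⟩)
      apply hp8
      obtain ⟨k, hk⟩ := this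
      exact ⟨k, by rw [hp4 p hp, hk]; ring⟩
    · have hT := hoff_count ((V.image (bxor p)).filter fun x => Odd (e x / 4)) 16
        (fun x hx => hcos_out p hp x (mem_filter.1 hx).1) (fun x hx => by
          have hx' := (mem_filter.1 hx)
          have hxP : x ∉ P := hcos_out p hp x hx'.1
          have h0' := Int.odd_iff.1 hx'.2
          have h2 := hp4 x hxP
          have : e x ≤ -4 ∨ 4 ≤ e x := by omega
          have := tp_sq_ge (k := 4) (by norm_num) this
          linarith)
      norm_num at hbig
      have : (128 : ℤ) ≤ #((V.image (bxor p)).filter fun x => Odd (e x / 4)) := by exact_mod_cast (by omega)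
      linarith
  -- round 3: `16 ∣ e` off `P`
  have hdiv16 : ∀ y, y ∉ P → (16 : ℤ) ∣ e y := by
    by_contra hcon
    push Not at hcon
    obtain ⟨p, hp, hp16⟩ := hcon
    have hp8 : ∀ y, y ∉ P → e y = 8 * (e y / 8) := fun y hy => (Int.mul_ediv_cancel' (hdiv8 y hy)).symm
    rcases ws_erm_round V h0 hadd hcardV p (fun y => e y / 8) 6 (fun b hb a ha => by
        have hpts : ∀ ε : Fin (6 + 1) → Bool, (fun j => b j ^^ decide (Odd #(univ.filter fun i => ε i && a i j))) ∉ P :=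
          fun ε => ws_flatPt_mem V h0 (· ∉ P) hPV' (6 + 1) b (hcos_out p hp b hb) a ha ε
        have h16 := hflat7 b a
        rw [sum_congr rfl fun ε _ => hp8 _ (hpts ε), ← mul_sum] at h16
        obtain ⟨k, hk⟩ := h16
        exact ⟨k, by linarith⟩) with hev | hbig
    · have := hev p (mem_image.2 ⟨zeroVec, h0, bxor_zeroVec p⟩)
      apply hp16
      obtain ⟨k, hk⟩ := this
      exact ⟨k, by rw [hp8 p hp, hk]; ring⟩
    · have hT := hoff_count ((V.image (bxor p)).filter fun x => Odd (e x / 8)) 64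
        (fun x hx => hcos_out p hp x (mem_filter.1 hx).1) (fun x hx => by
          have hx' := (mem_filter.1 hx)
          have hxP : x ∉ P := hcos_out p hp x hx'.1
          have h0' := Int.odd_iff.1 hx'.2
          have h2 := hp8 x hxP
          have : e x ≤ -8 ∨ 8 ≤ e x := by omega
          have := tp_sq_ge (k := 8) (by norm_num) this
          linarith)
      norm_num at hbig
      have : (32 : ℤ) ≤ #((V.image (bxor p)).filter fun x => Odd (e x / 8)) := by exact_mod_cast (by omega)
      linarith
  exact hdiv16


/-! ### Annihilator sums of `u'` by Walsh inversion -/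

/-- **The sum of `u' = W_g/32` over the zero set of a non-trivial affine function is `0` or `±128`** (Walsh inversion at `0` and at the
normal vector; `{ℓ = 0}` is the annihilator of the normal or its complement, `stub_affineForm`). [this work] -/
theorem tw5_annP (g : (Fin (6 + 6) → Bool) → Bool) (u' : (Fin (6 + 6) → Bool) → ℤ)
    (hu' : ∀ x, W (fun y => signOf (g y)) x = (2 : ℝ) ^ 5 * (u' x : ℝ)) (ℓ : (Fin (6 + 6) → Bool) → Bool) (hℓ : IsDegLeFun 1 ℓ) :
    (128 : ℤ) ∣ ∑ x ∈ univ.filter (fun x : Fin (6 + 6) → Bool => ℓ x = false), u' x := by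
  classical
  obtain ⟨c, b, hcb⟩ := stub_affineForm (6 + 6) ℓ hℓ
  -- inversion at `0` and at `c`
  have hinv : ∀ z : Fin (6 + 6) → Bool, ∑ x, (u' x : ℝ) * twist c x = 128 * signOf (g c) ∨ c ≠ z := fun z => by
    left
    have h := tz_inversion (fun y => signOf (g y)) c
    have e : ∀ x : Fin (6 + 6) → Bool, W (fun y => signOf (g y)) x * twist x c = (2 : ℝ) ^ 5 * ((u' x : ℝ) * twist c x) := fun x => by
      rw [hu' x, twist_comm]; ring
    rw [sum_congr rfl fun x _ => e x, ← mul_sum] at h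
    have e12 : (2 : ℝ) ^ (6 + 6) = 2 ^ 5 * 128 := by norm_num
    rw [e12, mul_assoc] at h
    exact mul_left_cancel₀ (by positivity) h
  have h0 : ∑ x, (u' x : ℝ) = 128 * signOf (g zeroVec) := by
    have h := tz_inversion (fun y => signOf (g y)) zeroVec
    have e : ∀ x : Fin (6 + 6) → Bool, W (fun y => signOf (g y)) x * twist x zeroVec = (2 : ℝ) ^ 5 * (u' x : ℝ) := fun x => by
      rw [twist_zeroVec_right, mul_one, hu' x]
    rw [sum_congr rfl fun x _ => e x, ← mul_sum] at h
    have e12 : (2 : ℝ) ^ (6 + 6) = 2 ^ 5 * 128 := by norm_num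
    rw [e12, mul_assoc] at h
    exact mul_left_cancel₀ (by positivity) h
  have hc := (hinv c).resolve_right (fun h => h rfl)
  -- `2 Σ_{ℓ = 0} u' = Σ u' (1 + signOf ℓ)` and `signOf ℓ = signOf b · twist c`
  have hind : ∀ x, (if ℓ x = false then (2 : ℝ) else 0) = 1 + signOf b * twist c x := by
    intro x
    rw [← hcb x]
    unfold signOf
    cases ℓ x <;> norm_num
  have h2 : 2 * ((∑ x ∈ univ.filter (fun x : Fin (6 + 6) → Bool => ℓ x = false), u' x : ℤ) : ℝ) =
      128 * signOf (g zeroVec) + signOf b * (128 * signOf (g c)) := by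
    have eL : 2 * ((∑ x ∈ univ.filter (fun x : Fin (6 + 6) → Bool => ℓ x = false), u' x : ℤ) : ℝ) =
        ∑ x, (if ℓ x = false then (2 : ℝ) else 0) * (u' x : ℝ) := by
      push_cast
      rw [mul_sum, sum_filter]
      exact sum_congr rfl fun x _ => by split_ifs <;> simp
    rw [eL, sum_congr rfl fun x _ => by rw [hind x], ← h0, ← hc, mul_sum, ← sum_add_distrib]
    exact sum_congr rfl fun x _ => by ring
  have h2Z : 2 * (∑ x ∈ univ.filter (fun x : Fin (6 + 6) → Bool => ℓ x = false), u' x) =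
      128 * sZ (g zeroVec) + 128 * (sZ b * sZ (g c)) := by
    have h' : ((2 * (∑ x ∈ univ.filter (fun x : Fin (6 + 6) → Bool => ℓ x = false), u' x) : ℤ) : ℝ) =
        ((128 * sZ (g zeroVec) + 128 * (sZ b * sZ (g c)) : ℤ) : ℝ) := by
      push_cast at h2 ⊢; rw [tp_sZ_cast, tp_sZ_cast, tp_sZ_cast]; linarith
    exact_mod_cast h'
  refine Dvd.intro ((∑ x ∈ univ.filter (fun x : Fin (6 + 6) → Bool => ℓ x = false), u' x) / 128) ?_
  rcases tp_sZ_cases (g zeroVec) with h1 | h1 <;> rcases tp_sZ_cases b with h3 | h3 <;> rcases tp_sZ_cases (g c) with h4 | h4 <;>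
    rw [h1, h3, h4] at h2Z <;> omega

end Summit.QuantumAdvantage.QuantumAdvantage.Theorems.CubicForrelation.NearExactIsExact

end
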